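import Summits.CriticalPhenomena.PercolationContinuityZ3.Theorems.PercNearOneGluingNoHeavyPcintBSMGreen
import Summits.CriticalPhenomena.PercolationContinuityZ3.Theorems.PercNearOneGluingNoHeavyPcintOSMTail
import HarnessLib

/-!
# PCINT lane, PHASE 5 (block-renewal second moment), step 7: uniform bounds for the partial Green sums

Cell `prim-pcint`, seat `prim-pcint-1` (gen 14); memo `run/shared/lean/prim/pcint/T-FIBRE-ROUTE.md` §PHASE 5.

The terms of the Green series of the pair offset chain are `u k i · Π_l F s (2i) (δ l)` (…BSMGreen).  With
`u k i ² ≤ k²/(4(k-1)(i+1))` (…BSMWords), `F s (2i) 0 ² ≤ 1/((2i+1)s)` (…BSMLazy), `F ≤ 1` and `t ≥ 3` transverse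
coordinates, AM–GM gives the RATIONAL tail bound (`BSM.term_le`)

  `u k i · Π_l F s (2i) (δ l) ≤ C k s · (1/i - 1/(i+1))`,   `C k s = k²/(16(k-1)s) + 1/(8s²)`   (`i ≥ 1`, `k ≥ 2`),

which telescopes: for every horizon `m` and every `N ≥ 1` (**`BSM.green_le`**, **`BSM.greenAdj_le`**)

  `Σ_{i<m} u k i Π_l F … ≤ G0N N δ + C k s / N`,  `Σ_{i<m} c_i Π_l F … ≤ G1N N δ + C k s / N`,

with the finite sums `G0N`, `G1N` over `i < N` and the adjacent-class coefficients
`c_i = (k² u (i+1) - k u i)/(k(k-1)) ∈ [0, u i]`.  Tail bounds are packaged as `BSM.TailBound`; for `k ≥ 5` and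
`N = q₀ k` the OSM tail of `Σ u_i` (`OSM.sum_u_le_Gplus`) times `F(2N)(0)³` is a much smaller one (**`BSM.tailBound_osm`**).
-/

noncomputable section

namespace Summit.CriticalPhenomena.PercolationContinuityZ3.Theorems.Pcint.BSM

open Finset OSM

variable {t k : ℕ}

/-! ### `F ≤ 1` -/

/-- `F s N 0 ≤ 1`. -/
theorem F_zero_le_one {s : ℝ} (hs0 : 0 ≤ s) (hs1 : s ≤ 1) : ∀ N : ℕ, F s N 0 ≤ 1
  | 0 => by rw [F_zero]; simp
  | N + 1 => by
    rw [F_succ_sum]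
    calc ∑ c : Fin 3, g₃ s c * F s N (0 - val c) ≤ ∑ c : Fin 3, g₃ s c * 1 :=
          sum_le_sum fun c _ => mul_le_mul_of_nonneg_left
            ((F_le_F_zero hs0 hs1 N _).trans (F_zero_le_one hs0 hs1 N)) (g₃_nonneg hs0 hs1 c)
      _ = 1 := by rw [← sum_mul, sum_g₃, one_mul]

/-- `F s N δ ≤ 1`. -/
theorem F_le_one {s : ℝ} (hs0 : 0 ≤ s) (hs1 : s ≤ 1) (N : ℕ) (δ : ℤ) : F s N δ ≤ 1 :=
  (F_le_F_zero hs0 hs1 N δ).trans (F_zero_le_one hs0 hs1 N)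

/-- `Π_l F s N (δ l) ≤ F s N 0 ^ 3` for `t ≥ 3` coordinates. -/
theorem prod_F_le {s : ℝ} (hs0 : 0 ≤ s) (hs1 : s ≤ 1) (ht : 3 ≤ t) (N : ℕ) (δ : Fin t → ℤ) :
    ∏ l, F s N (δ l) ≤ F s N 0 ^ 3 := by
  calc ∏ l, F s N (δ l) ≤ ∏ _l : Fin t, F s N 0 :=
        prod_le_prod (fun _ _ => F_nonneg hs0 hs1 N _) fun _ _ => F_le_F_zero hs0 hs1 N _
    _ = F s N 0 ^ t := by rw [prod_const, card_univ, Fintype.card_fin]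
    _ ≤ F s N 0 ^ 3 := pow_le_pow_of_le_one (F_nonneg hs0 hs1 N 0) (F_zero_le_one hs0 hs1 N) ht

/-- `Π_l F ≥ 0`. -/
theorem prod_F_nonneg {s : ℝ} (hs0 : 0 ≤ s) (hs1 : s ≤ 1) (N : ℕ) (δ : Fin t → ℤ) : 0 ≤ ∏ l, F s N (δ l) :=
  prod_nonneg fun _ _ => F_nonneg hs0 hs1 N _

/-! ### The rational tail bound -/

/-- The tail constant `C k s = k²/(16(k-1)s) + 1/(8s²)`. -/
def Ctail (k : ℕ) (s : ℝ) : ℝ := (k : ℝ) ^ 2 / (16 * ((k : ℝ) - 1) * s) + 1 / (8 * s ^ 2)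

/-- `Ctail ≥ 0` for `k ≥ 2`, `s > 0`. -/
theorem Ctail_nonneg (hk : 2 ≤ k) {s : ℝ} (hs0 : 0 < s) : 0 ≤ Ctail k s := by
  have hk1 : (1 : ℝ) ≤ (k : ℝ) - 1 := by
    have : (2 : ℝ) ≤ k := by exact_mod_cast hk
    linarith
  unfold Ctail; positivity

/-- **The term bound**: `u k i · Π_l F s (2i) (δ l) ≤ C k s (1/i - 1/(i+1))` for `i ≥ 1`, `k ≥ 2`, `t ≥ 3`. -/
theorem term_le (hk : 2 ≤ k) (ht : 3 ≤ t) {s : ℝ} (hs0 : 0 < s) (hs1 : s ≤ 1) {i : ℕ} (hi : 1 ≤ i) (δ : Fin t → ℤ) :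
    u k i * ∏ l, F s (2 * i) (δ l) ≤ Ctail k s * (1 / (i : ℝ) - 1 / ((i : ℝ) + 1)) := by
  have hk1 : (1 : ℝ) ≤ (k : ℝ) - 1 := by
    have : (2 : ℝ) ≤ k := by exact_mod_cast hk
    linarith
  have hi1 : (1 : ℝ) ≤ i := by exact_mod_cast hi
  set a := F s (2 * i) 0 with ha
  set b := u k i with hb
  have ha0 : 0 ≤ a := F_nonneg hs0.le hs1 _ _
  have hb0 : 0 ≤ b := u_nonneg i
  -- the two squared inputs
  set A : ℝ := 1 / ((2 * (i : ℝ) + 1) * s) with hA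
  set B : ℝ := (k : ℝ) ^ 2 / (4 * ((k : ℝ) - 1) * ((i : ℝ) + 1)) with hB
  have haA : a ^ 2 ≤ A := by
    have := F_zero_sq_le hs0 hs1 (2 * i)
    rw [hA]; convert this using 2; push_cast; ring
  have hbB : b ^ 2 ≤ B := by rw [hB, hb]; exact u_sq_le hk i
  have hA0 : 0 ≤ A := by rw [hA]; positivity
  have hB0 : 0 ≤ B := by rw [hB]; positivity
  -- `b a³ ≤ ((B + A)/2) A`
  have h1 : u k i * ∏ l, F s (2 * i) (δ l) ≤ b * a ^ 3 :=
    mul_le_mul_of_nonneg_left (prod_F_le hs0.le hs1 ht _ δ) hb0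
  have h2 : b * a ^ 3 ≤ (B + A) / 2 * A := by
    have hba : b * a ≤ (B + A) / 2 := by nlinarith [sq_nonneg (b - a)]
    calc b * a ^ 3 = (b * a) * a ^ 2 := by ring
      _ ≤ (B + A) / 2 * A := mul_le_mul hba haA (sq_nonneg a) (by linarith)
  -- `((B + A)/2) A ≤ C (1/i - 1/(i+1))`
  have h3 : (B + A) / 2 * A ≤ Ctail k s * (1 / (i : ℝ) - 1 / ((i : ℝ) + 1)) := by
    have hi0 : (i : ℝ) ≠ 0 := by positivity
    have hk1' : (k : ℝ) - 1 ≠ 0 := by positivity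
    have hii : 1 / (i : ℝ) - 1 / ((i : ℝ) + 1) = 1 / ((i : ℝ) * ((i : ℝ) + 1)) := by
      field_simp; ring
    have hA' : A ≤ 1 / (2 * (i : ℝ) * s) := by
      rw [hA]; exact one_div_le_one_div_of_le (by positivity) (by nlinarith)
    have hA2 : A * A ≤ 1 / (4 * ((i : ℝ) * ((i : ℝ) + 1)) * s ^ 2) := by
      rw [hA, one_div_mul_one_div]; exact one_div_le_one_div_of_le (by positivity) (by nlinarith [hs0])
    calc (B + A) / 2 * A = B * A / 2 + A * A / 2 := by ring
      _ ≤ B * (1 / (2 * (i : ℝ) * s)) / 2 + 1 / (4 * ((i : ℝ) * ((i : ℝ) + 1)) * s ^ 2) / 2 :=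
          add_le_add (div_le_div_of_nonneg_right (mul_le_mul_of_nonneg_left hA' hB0) (by norm_num))
            (div_le_div_of_nonneg_right hA2 (by norm_num))
      _ = Ctail k s * (1 / (i : ℝ) - 1 / ((i : ℝ) + 1)) := by
          rw [hii, hB, Ctail]
          field_simp
          ring
  exact h1.trans (h2.trans h3)

/-- **Telescoping**: `Σ_{i ∈ [N, m)} (1/i - 1/(i+1)) ≤ 1/N`. -/
theorem sum_Ico_telescope_le (N m : ℕ) :
    ∑ i ∈ Ico N m, (1 / (i : ℝ) - 1 / ((i : ℝ) + 1)) ≤ 1 / (N : ℝ) := by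
  by_cases h : N ≤ m
  · rw [Finset.sum_Ico_eq_sub _ h]
    have tel : ∀ M : ℕ, ∑ i ∈ range M, (1 / (i : ℝ) - 1 / ((i : ℝ) + 1)) = -(1 / (M : ℝ)) := by
      intro M
      induction M with
      | zero => simp
      | succ M ih => rw [sum_range_succ, ih]; push_cast; ring
    rw [tel, tel]
    have : 0 ≤ 1 / (m : ℝ) := by positivity
    linarith
  · rw [Finset.Ico_eq_empty (by omega), sum_empty]; positivity

/-! ### Uniform bounds of the partial Green sums -/

/-- The finite diagonal sum `G0N N δ = Σ_{i<N} u k i Π_l F s (2i) (δ l)`. -/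
def G0N (k : ℕ) (s : ℝ) (N : ℕ) (δ : Fin t → ℤ) : ℝ := ∑ i ∈ range N, u k i * ∏ l, F s (2 * i) (δ l)

/-- The adjacent-class coefficient `c_i = (k² u (i+1) - k u i)/(k(k-1))`. -/
def cadj (k i : ℕ) : ℝ := ((k : ℝ) ^ 2 * u k (i + 1) - k * u k i) / ((k : ℝ) * ((k : ℝ) - 1))

/-- The finite adjacent sum `G1N N δ = Σ_{i<N} c_i Π_l F s (2i) (δ l)`. -/
def G1N (k : ℕ) (s : ℝ) (N : ℕ) (δ : Fin t → ℤ) : ℝ := ∑ i ∈ range N, cadj k i * ∏ l, F s (2 * i) (δ l)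

/-- `0 ≤ c_i ≤ u i` for `k ≥ 2`. -/
theorem cadj_bounds (hk : 2 ≤ k) (i : ℕ) : 0 ≤ cadj k i ∧ cadj k i ≤ u k i := by
  have hk0 : 0 < k := by omega
  have hk1 : (1 : ℝ) ≤ (k : ℝ) - 1 := by
    have : (2 : ℝ) ≤ k := by exact_mod_cast hk
    linarith
  have hden : (0 : ℝ) < (k : ℝ) * ((k : ℝ) - 1) := by positivity
  unfold cadj
  refine ⟨div_nonneg (adj_coeff_nonneg hk0 i) hden.le, ?_⟩
  rw [div_le_iff₀ hden]
  have := adj_coeff_le hk0 i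
  linarith

/-- A generic uniform bound: nonnegative terms dominated by `C (1/i - 1/(i+1))` beyond `N ≥ 1`. -/
theorem sum_le_partial_add {f : ℕ → ℝ} {C : ℝ} (hC : 0 ≤ C) (hf : ∀ i, 0 ≤ f i) {N : ℕ} (hN : 1 ≤ N)
    (hfC : ∀ i, N ≤ i → f i ≤ C * (1 / (i : ℝ) - 1 / ((i : ℝ) + 1))) (m : ℕ) :
    ∑ i ∈ range m, f i ≤ ∑ i ∈ range N, f i + C / N := by
  have hCN : 0 ≤ C / N := by positivity
  by_cases h : m ≤ N
  · calc ∑ i ∈ range m, f i ≤ ∑ i ∈ range N, f i :=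
          sum_le_sum_of_subset_of_nonneg (range_mono h) fun i _ _ => hf i
      _ ≤ _ := le_add_of_nonneg_right hCN
  · have hNm : N ≤ m := by omega
    rw [← Finset.sum_range_add_sum_Ico _ hNm]
    refine add_le_add le_rfl ?_
    calc ∑ i ∈ Ico N m, f i ≤ ∑ i ∈ Ico N m, C * (1 / (i : ℝ) - 1 / ((i : ℝ) + 1)) :=
          sum_le_sum fun i hi => hfC i (mem_Ico.1 hi).1
      _ = C * ∑ i ∈ Ico N m, (1 / (i : ℝ) - 1 / ((i : ℝ) + 1)) := by rw [mul_sum]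
      _ ≤ C * (1 / (N : ℝ)) := mul_le_mul_of_nonneg_left (sum_Ico_telescope_le N m) hC
      _ = C / N := by ring

/-- **Uniform bound of the diagonal Green sums**:
`Σ_{i<m} u k i Π_l F s (2i) (δ l) ≤ G0N N δ + C k s / N` for all `m` (`N ≥ 1`, `k ≥ 2`, `t ≥ 3`). -/
theorem green_le (hk : 2 ≤ k) (ht : 3 ≤ t) {s : ℝ} (hs0 : 0 < s) (hs1 : s ≤ 1) {N : ℕ} (hN : 1 ≤ N) (m : ℕ)
    (δ : Fin t → ℤ) :
    ∑ i ∈ range m, u k i * ∏ l, F s (2 * i) (δ l) ≤ G0N k s N δ + Ctail k s / N :=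
  sum_le_partial_add (f := fun i => u k i * ∏ l, F s (2 * i) (δ l)) (Ctail_nonneg hk hs0)
    (fun i => mul_nonneg (u_nonneg i) (prod_F_nonneg hs0.le hs1 _ δ)) hN
    (fun _ hi => term_le hk ht hs0 hs1 (hN.trans hi) δ) m

/-- **Uniform bound of the adjacent Green sums**:
`Σ_{i<m} c_i Π_l F s (2i) (δ l) ≤ G1N N δ + C k s / N` for all `m`. -/
theorem greenAdj_le (hk : 2 ≤ k) (ht : 3 ≤ t) {s : ℝ} (hs0 : 0 < s) (hs1 : s ≤ 1) {N : ℕ} (hN : 1 ≤ N) (m : ℕ)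
    (δ : Fin t → ℤ) :
    ∑ i ∈ range m, cadj k i * ∏ l, F s (2 * i) (δ l) ≤ G1N k s N δ + Ctail k s / N :=
  sum_le_partial_add (f := fun i => cadj k i * ∏ l, F s (2 * i) (δ l)) (Ctail_nonneg hk hs0)
    (fun i => mul_nonneg (cadj_bounds hk i).1 (prod_F_nonneg hs0.le hs1 _ δ)) hN
    (fun i hi => (mul_le_mul_of_nonneg_right (cadj_bounds hk i).2 (prod_F_nonneg hs0.le hs1 _ δ)).trans
      (term_le hk ht hs0 hs1 (hN.trans hi) δ)) m

/-! ### Tail bounds as a package; the OSM tail for `k ≥ 5` -/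

/-- **A tail bound `T` for the Green sums at horizon `N`**: nonnegative, and the partial sums of both the diagonal and
the adjacent Green series are below the finite sums to horizon `N` plus `T`, uniformly in the horizon `m`. -/
def TailBound (t k : ℕ) (s : ℝ) (N : ℕ) (T : ℝ) : Prop :=
  0 ≤ T ∧ ∀ (m : ℕ) (δ : Fin t → ℤ),
    (∑ i ∈ range m, u k i * ∏ l, F s (2 * i) (δ l) ≤ G0N k s N δ + T) ∧
      (∑ i ∈ range m, cadj k i * ∏ l, F s (2 * i) (δ l) ≤ G1N k s N δ + T)

/-- The rational tail `Ctail k s / N` is a tail bound. -/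
theorem tailBound_ctail (hk : 2 ≤ k) (ht : 3 ≤ t) {s : ℝ} (hs0 : 0 < s) (hs1 : s ≤ 1) {N : ℕ} (hN : 1 ≤ N) {T : ℝ}
    (hT : Ctail k s / N ≤ T) : TailBound t k s N T :=
  ⟨(div_nonneg (Ctail_nonneg hk hs0) (Nat.cast_nonneg N)).trans hT, fun m δ =>
    ⟨(green_le hk ht hs0 hs1 hN m δ).trans (by linarith), (greenAdj_le hk ht hs0 hs1 hN m δ).trans (by linarith)⟩⟩

/-- `F s (n+1) 0 ≤ F s n 0`. -/
theorem F_zero_succ_le {s : ℝ} (hs0 : 0 ≤ s) (hs1 : s ≤ 1) (n : ℕ) : F s (n + 1) 0 ≤ F s n 0 := by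
  rw [F_succ]
  have h1 := F_le_F_zero hs0 hs1 n (0 - 1)
  have h2 := F_le_F_zero hs0 hs1 n (0 + 1)
  have h3 := mul_le_mul_of_nonneg_left (add_le_add h1 h2) (by linarith : 0 ≤ s / 4)
  linarith

/-- `n ↦ F s n 0` is non-increasing. -/
theorem F_zero_antitone {s : ℝ} (hs0 : 0 ≤ s) (hs1 : s ≤ 1) {m n : ℕ} (h : m ≤ n) : F s n 0 ≤ F s m 0 := by
  induction n with
  | zero => rw [Nat.le_zero.1 h]
  | succ n ih =>
    rcases Nat.of_le_succ h with h' | h'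
    · exact (F_zero_succ_le hs0 hs1 n).trans (ih h')
    · rw [h']

/-- **The OSM tail** `k · B(k, q₀) · (q₀+1)²/q₀ = Gplus k q₀ − Σ_{i<q₀k} u k i` of the oriented meeting series. -/
def TailU (k q₀ : ℕ) : ℝ := (k : ℝ) * OSM.B k q₀ * ((q₀ : ℝ) + 1) ^ 2 / q₀

/-- `TailU` is the gap between `Gplus` and the partial sum. -/
theorem TailU_eq (k q₀ : ℕ) : TailU k q₀ = Gplus k q₀ - ∑ i ∈ range (q₀ * k), u k i := by
  unfold TailU Gplus
  rw [sum_congr rfl fun i _ => u_eq_Mrec (d := k) i]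
  ring

/-- The oriented meeting series beyond `q₀ k` is below the OSM tail (`k ≥ 5`). -/
theorem sum_Ico_u_le (hk : 5 ≤ k) {q₀ : ℕ} (hq₀ : 1 ≤ q₀) (m : ℕ) :
    ∑ i ∈ Ico (q₀ * k) m, u k i ≤ TailU k q₀ := by
  rcases le_or_gt (q₀ * k) m with h | h
  · have := sum_u_le_Gplus hk hq₀ m
    rw [← sum_range_add_sum_Ico _ h] at this
    rw [TailU_eq]; linarith
  · rw [Ico_eq_empty_of_le h.le, sum_empty, TailU_eq]
    have := sum_u_le_Gplus hk hq₀ (q₀ * k); linarith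

/-- **Partial Green sums with coefficients `c_i ≤ u_i` are below the finite sum plus `F(2N)(0)³ · TailU`**
(`k ≥ 5`, `N = q₀ k`, `t ≥ 3`): the terms beyond `N` have `Π_l F ≤ F(2i)(0)³ ≤ F(2N)(0)³`. -/
theorem sum_le_osm (hk : 5 ≤ k) (ht : 3 ≤ t) {s : ℝ} (hs0 : 0 < s) (hs1 : s ≤ 1) {q₀ : ℕ} (hq₀ : 1 ≤ q₀) {N : ℕ}
    (hN : N = q₀ * k) {c : ℕ → ℝ} (hc0 : ∀ i, 0 ≤ c i) (hcu : ∀ i, c i ≤ u k i) (m : ℕ) (δ : Fin t → ℤ) :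
    ∑ i ∈ range m, c i * ∏ l, F s (2 * i) (δ l) ≤
      (∑ i ∈ range N, c i * ∏ l, F s (2 * i) (δ l)) + F s (2 * N) 0 ^ 3 * TailU k q₀ := by
  have hterm0 : ∀ i, 0 ≤ c i * ∏ l, F s (2 * i) (δ l) := fun i => mul_nonneg (hc0 i) (prod_F_nonneg hs0.le hs1 _ δ)
  have hT0 : 0 ≤ F s (2 * N) 0 ^ 3 * TailU k q₀ :=
    mul_nonneg (pow_nonneg (F_nonneg hs0.le hs1 _ _) 3) (by
      have := sum_Ico_u_le hk hq₀ (q₀ * k); rwa [Ico_self, sum_empty] at this)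
  rcases le_or_gt m N with h | h
  · exact (sum_le_sum_of_subset_of_nonneg (range_subset_range.2 h) fun i _ _ => hterm0 i).trans
      (le_add_of_nonneg_right hT0)
  · rw [← sum_range_add_sum_Ico _ h.le]
    refine add_le_add le_rfl ?_
    calc ∑ i ∈ Ico N m, c i * ∏ l, F s (2 * i) (δ l) ≤ ∑ i ∈ Ico N m, u k i * F s (2 * N) 0 ^ 3 :=
          sum_le_sum fun i hi => by
            have hNi : N ≤ i := (mem_Ico.1 hi).1
            refine mul_le_mul (hcu i) ((prod_F_le hs0.le hs1 ht _ δ).trans ?_) (prod_F_nonneg hs0.le hs1 _ δ)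
              (u_nonneg i)
            exact pow_le_pow_left₀ (F_nonneg hs0.le hs1 _ _) (F_zero_antitone hs0.le hs1 (by omega)) 3
      _ = F s (2 * N) 0 ^ 3 * ∑ i ∈ Ico N m, u k i := by rw [mul_sum]; exact sum_congr rfl fun i _ => mul_comm _ _
      _ ≤ F s (2 * N) 0 ^ 3 * TailU k q₀ :=
          mul_le_mul_of_nonneg_left (by rw [hN]; exact sum_Ico_u_le hk hq₀ m) (pow_nonneg (F_nonneg hs0.le hs1 _ _) 3)

/-- **The OSM tail bound** (`k ≥ 5`, `N = q₀ k`): `F(2N)(0)³ · TailU k q₀` (or anything larger) is a tail bound. -/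
theorem tailBound_osm (hk : 5 ≤ k) (ht : 3 ≤ t) {s : ℝ} (hs0 : 0 < s) (hs1 : s ≤ 1) {q₀ : ℕ} (hq₀ : 1 ≤ q₀)
    {N : ℕ} (hN : N = q₀ * k) {T : ℝ} (hT : F s (2 * N) 0 ^ 3 * TailU k q₀ ≤ T) : TailBound t k s N T := by
  have h2 : 2 ≤ k := by omega
  refine ⟨le_trans (mul_nonneg (pow_nonneg (F_nonneg hs0.le hs1 _ _) 3) ?_) hT, fun m δ => ⟨?_, ?_⟩⟩
  · have := sum_Ico_u_le hk hq₀ (q₀ * k); rwa [Ico_self, sum_empty] at this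
  · exact (sum_le_osm hk ht hs0 hs1 hq₀ hN (fun i => u_nonneg i) (fun i => le_rfl) m δ).trans
      (by unfold G0N; exact add_le_add le_rfl hT)
  · exact (sum_le_osm hk ht hs0 hs1 hq₀ hN (fun i => (cadj_bounds h2 i).1) (fun i => (cadj_bounds h2 i).2) m δ).trans
      (by unfold G1N; exact add_le_add le_rfl hT)

end Summit.CriticalPhenomena.PercolationContinuityZ3.Theorems.Pcint.BSM

end
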